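import Literature.NumberTheory.Transcendental.WeakCITSchanuel
import Literature.NumberTheory.Transcendental.ZilberFieldSaturationMain
import HarnessLib

/-!
# Horizontal weak Zilber–Pink, step 1: the Schanuel bound in one differential field, relative to
an ambient subtorus and with an additive block

Support file for the uniform ("horizontal semiabelian") weak Zilber–Pink theorem for
`𝔾ₐ^{N'} × 𝔾ₘ^m` (Bays–Kirby 2018, Thm 11.4 / Fact 11.3; Zilber 2002, Cor. 3; Kirby 2009,
Thm 4.6), proved — like the tree's non-uniform weak CIT
(`Literature.NumberTheory.Transcendental.weakCIT_holds`, `IntersectionsWithToriProofs.lean`) — from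
Ax's theorem (`ax_schanuel_of_field`) and an explicit ultraproduct. This file generalises the
one-field Schanuel bound `WeakCIT.exists_int_relation` of `WeakCITSchanuel.lean` in the three ways
the horizontal, uniform and "relative to `H`" version needs:

* an **additive block** `u ∈ F^{N'}` of coordinates without logarithms (points of
  `𝔾ₐ^{N'} × 𝔾ₘ^m`), with a Jacobian that is the identity on a set `S = S_y ⊔ S_u` of coordinates
  of *both* blocks, the derivations indexed by `S_u` killing the multiplicative block;
* an **ambient subtorus `H`**: an integer unimodular change of coordinates `U_H` a set `I_H` of
  whose rows give constant logarithms; Ax's theorem is applied to the remaining logarithms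
  `x̃ = (U_H x)_{i ∉ I_H}` and monomials `ỹ = y^{U_H}`, so that the integer relation produced avoids
  the rows `I_H`;
* a **certificate of dimension by relative rank**: instead of a fixed ideal of which `y` is a
  zero, a set `k'` of constants with `relRank (k') (u ∪ y) ≤ d` in the algebraic matroid of `F/ℚ`
  (`GammaField.algMatroid`), which is what the ultraproduct of a *varying* family provides.

Main result: `WeakZP.exists_int_relation_rel`. Auxiliary: `WeakZP.kerField` (common kernel of
derivations as an intermediate field of `F/ℚ`), `WeakZP.overField` (a derivation as a derivation
over a subfield it kills), `WeakZP.algebraicIndependent_of_jacobian` (identity Jacobian for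
derivations killing `L` ⟹ algebraic independence over `L`; Rosenlicht 1976, Prop. 3, via the
tree's `finrank_span_le_trdeg_adjoin`).

## The count

With constants `C ⊇ k'`, `h = |I_H|`, `ρ = |J|` (constant coordinates of `x' = V x`) and no
integer relation among `x̃` modulo `C` off `I_H`, Ax's theorem gives
`(m - h) + rank (D x̃) ≤ trdeg_C C[x̃, ỹ]`; here `rank (D x̃) = rank (D x) ≥ |S_y|` (`U_H` is
invertible and its `I_H`-rows give zero rows), and in relative ranks
`trdeg_C C[x̃, ỹ] ≤ relRank C (x' ∪ y) ≤ (m - ρ) + relRank k' (y)`, while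
`relRank k' (y) + |S_u| ≤ relRank k' (u ∪ y) ≤ d` because `u_{S_u}` is algebraically independent
over `ℚ(k', y)` (identity Jacobian of derivations killing that field). Hence `|S| + ρ ≤ d + h`.

## References

* J. Ax, *On Schanuel's conjectures*, Ann. of Math. 93 (1971), Thm 3.
* J. Kirby, *The theory of the exponential differential equations of semiabelian varieties*,
  Selecta Math. 15 (2009), Thm 4.3, Thm 4.6.
* M. Bays, J. Kirby, *Pseudo-exponential maps, variants, and quasiminimality*, Algebra & Number
  Theory 12 (2018), Fact 11.3, Thm 11.4.
* M. Rosenlicht, *On Liouville's theory of elementary functions*, Pacific J. Math. 65 (1976), Prop. 3.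
-/

noncomputable section

open MvPolynomial Set Cardinal

namespace Literature.NumberTheory.Transcendental.WeakZP

open WeakCIT GammaField Matroid

variable {F : Type} [Field F] [CharZero F]

/-! ### Derivations over subfields they kill -/

section OverField

/-- The common kernel of a family of derivations of `F`, as an intermediate field of `F/ℚ`
(kernels of derivations of a field of characteristic zero are subfields containing `ℚ`).
[folklore] -/
def kerField {ι : Type*} (E : ι → Derivation ℤ F F) : IntermediateField ℚ F :=
  Subfield.toIntermediateField
    { carrier := {a | ∀ s, E s a = 0}
      mul_mem' := fun {a b} ha hb s => by simp [Derivation.leibniz, ha s, hb s]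
      one_mem' := fun s => Derivation.map_one_eq_zero _
      add_mem' := fun {a b} ha hb s => by simp [map_add, ha s, hb s]
      zero_mem' := fun s => map_zero _
      neg_mem' := fun {a} ha s => by simp [map_neg, ha s]
      inv_mem' := fun a ha s => by
        rcases eq_or_ne a 0 with rfl | ha0
        · simp
        · have h : E s (a * a⁻¹) = 0 := by
            rw [mul_inv_cancel₀ ha0]; exact Derivation.map_one_eq_zero _
          rw [Derivation.leibniz, ha s, smul_zero, add_zero, smul_eq_mul] at h
          exact (mul_eq_zero.1 h).resolve_left ha0 }
    (fun q => by rw [eq_ratCast]; exact SubfieldClass.ratCast_mem _ q)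

/-- Membership in `kerField`. [folklore] -/
theorem mem_kerField_iff {ι : Type*} {E : ι → Derivation ℤ F F} {a : F} :
    a ∈ kerField E ↔ ∀ s, E s a = 0 :=
  Iff.rfl

/-- A derivation killing an intermediate field `L` of `F/ℚ` is an `L`-derivation. [folklore] -/
def overField (L : IntermediateField ℚ F) (D : Derivation ℤ F F) (h : ∀ z ∈ L, D z = 0) :
    Derivation L F F where
  toFun := D
  map_add' := map_add D
  map_smul' r a := by
    show D ((r : F) * a) = (r : F) * D a
    rw [Derivation.leibniz, h r r.2, smul_zero, add_zero, smul_eq_mul]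
  map_one_eq_zero' := D.map_one_eq_zero
  leibniz' a b := D.leibniz a b

/-- Unfolding `overField`. [folklore] -/
@[simp] theorem overField_apply (L : IntermediateField ℚ F) (D : Derivation ℤ F F)
    (h : ∀ z ∈ L, D z = 0) (a : F) : overField L D h a = D a :=
  rfl

/-- **Identity Jacobian ⟹ algebraic independence** (Rosenlicht 1976, Prop. 3, "`dim ≤ trdeg`", in
the form: if derivations `E_s` of `F` kill the subfield `L` and `E_s (v_t) = δ_{st}`, then `v` is
algebraically independent over `L`). The `K`-span of the vectors `(E_s v_t)_s` is everything, and
its dimension is at most `trdeg_L L[v]` (`finrank_span_le_trdeg_adjoin`). [cite: Rosenlicht1976, Prop. 3] -/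
theorem algebraicIndependent_of_jacobian {ι : Type} [Fintype ι] [DecidableEq ι]
    (L : IntermediateField ℚ F) (E : ι → Derivation ℤ F F) (hE : ∀ s, ∀ z ∈ L, E s z = 0)
    (v : ι → F) (hv : ∀ s t, E s (v t) = (Pi.single t (1 : F) : ι → F) s) :
    AlgebraicIndependent L v := by
  classical
  -- the derivation `δ = (E_s)_s : F → F^ι` over `L`
  let δ : Derivation L F (ι → F) :=
    { toFun := fun z s => E s z
      map_add' := fun a b => funext fun s => map_add _ _ _
      map_smul' := fun r a => funext fun s => by
        show E s ((r : F) * a) = ((r : F) • fun s => E s a) s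
        rw [Derivation.leibniz, hE s r r.2, smul_zero, add_zero, Pi.smul_apply, smul_eq_mul]
      map_one_eq_zero' := funext fun s => (E s).map_one_eq_zero
      leibniz' := fun a b => funext fun s => by
        show E s (a * b) = (a • (fun s => E s b) + b • fun s => E s a) s
        rw [Derivation.leibniz]
        simp [smul_eq_mul] }
  have hδ : ∀ t, δ (v t) = Pi.single t (1 : F) := fun t => funext fun s => hv s t
  -- its span on `v` is everything
  have hspan : Submodule.span F (δ '' Set.range v) = ⊤ := by
    have : δ '' Set.range v = Set.range fun t => (Pi.single t (1 : F) : ι → F) := by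
      ext w
      simp only [Set.mem_image, Set.mem_range, exists_exists_eq_and, hδ]
    have hb : (⇑(Pi.basisFun F ι) : ι → ι → F) = fun t => Pi.single t 1 :=
      funext fun t => Pi.basisFun_apply F ι t
    rw [this, ← hb]
    exact (Pi.basisFun F ι).span_eq
  have hfin : (Module.finrank F (Submodule.span F (δ '' Set.range v)) : Cardinal) =
      Fintype.card ι := by
    rw [hspan, finrank_top, Module.finrank_fintype_fun_eq_card]
  have hle : (Fintype.card ι : Cardinal) ≤ Algebra.trdeg L (Algebra.adjoin L (Set.range v)) := by
    rw [← hfin]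
    exact Rosenlicht.finrank_span_le_trdeg_adjoin δ (Set.range v) (Set.finite_range v)
  -- hence `v` is a transcendence basis of `L[v]`
  set A : Subalgebra L F := Algebra.adjoin L (Set.range v) with hA
  let w : ι → A := fun t => ⟨v t, Algebra.subset_adjoin ⟨t, rfl⟩⟩
  have hwtop : Algebra.adjoin L (Set.range w) = ⊤ := by
    apply Subalgebra.map_injective (f := A.val) Subtype.val_injective
    rw [AlgHom.map_adjoin, Algebra.map_top, Subalgebra.range_val, ← Set.range_comp]
    rfl
  haveI : Algebra.IsAlgebraic (Algebra.adjoin L (Set.range w)) A :=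
    ⟨fun b => isAlgebraic_algebraMap (⟨b, by rw [hwtop]; exact Algebra.mem_top⟩ :
      Algebra.adjoin L (Set.range w))⟩
  haveI : FaithfulSMul L A := (faithfulSMul_iff_algebraMap_injective L A).2 (algebraMap L A).injective
  have hcard : #ι ≤ Algebra.trdeg L A := by
    rw [Cardinal.mk_fintype]; exact hle
  have hw : IsTranscendenceBasis L w :=
    Algebra.IsAlgebraic.isTranscendenceBasis_of_le_trdeg_of_finite L w hcard
  exact hw.1.map' (f := A.val) Subtype.val_injective

end OverField


/-! ### Small lemmas on derivations and integer matrices -/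

section Lemmas

omit [CharZero F] in
/-- `D (n a) = n D a` for an integer `n`. [folklore] -/
theorem derivation_intCast_mul (D : Derivation ℤ F F) (n : ℤ) (a : F) :
    D ((n : F) * a) = (n : F) * D a := by
  rw [Derivation.leibniz, D.map_intCast, smul_zero, add_zero, smul_eq_mul]

omit [CharZero F] in
/-- `D (Σ nₗ xₗ) = Σ nₗ D xₗ` for integers `nₗ`. [folklore] -/
theorem derivation_sum_intCast_mul (D : Derivation ℤ F F) {ι : Type*} (s : Finset ι) (n : ι → ℤ)
    (x : ι → F) : D (∑ l ∈ s, (n l : F) * x l) = ∑ l ∈ s, (n l : F) * D (x l) := by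
  rw [map_sum]
  exact Finset.sum_congr rfl fun l _ => derivation_intCast_mul D (n l) (x l)

omit [CharZero F] in
/-- **Monomials are exponentials of integer combinations of logarithms**: if `D yₗ = yₗ D xₗ`
(`yₗ ≠ 0`) then `D (∏ yₗ^{nₗ}) = (∏ yₗ^{nₗ}) · D (Σ nₗ xₗ)`. [folklore] -/
theorem derivation_prod_zpow (D : Derivation ℤ F F) {ι : Type*} [Fintype ι] (x y : ι → F)
    (hy : ∀ l, y l ≠ 0) (hexp : ∀ l, D (y l) = y l * D (x l)) (n : ι → ℤ) :
    D (∏ l, y l ^ n l) = (∏ l, y l ^ n l) * D (∑ l, (n l : F) * x l) := by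
  have hP : (∏ l, y l ^ n l) ≠ 0 := Finset.prod_ne_zero_iff.mpr fun l _ => zpow_ne_zero _ (hy l)
  have h := inv_mul_derivation_prod_zpow D Finset.univ y (fun l _ => hy l) n
  rw [inv_mul_eq_iff_eq_mul₀ hP] at h
  rw [h, derivation_sum_intCast_mul]
  congr 1
  refine Finset.sum_congr rfl fun l _ => ?_
  rw [hexp l, inv_mul_cancel_left₀ (hy l)]

omit [CharZero F] in
/-- Dropping zero rows does not change the rank: if every row of `Q` outside the range of `f` is
zero, the submatrix of `Q` on the rows `f` has the rank of `Q`. [folklore] -/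
theorem rank_submatrix_eq_of_rows_eq_zero {m' n' : Type*} [Fintype m'] [Fintype n'] {k : Type*}
    [Fintype k] (Q : Matrix m' n' F) (f : k → m') (h0 : ∀ i, i ∉ Set.range f → Q i = 0) :
    (Q.submatrix f id).rank = Q.rank := by
  classical
  rw [Matrix.rank_eq_finrank_span_row, Matrix.rank_eq_finrank_span_row]
  have : Submodule.span F (Set.range (Q.submatrix f id).row) =
      Submodule.span F (Set.range Q.row) := by
    apply le_antisymm
    · refine Submodule.span_mono ?_
      rintro _ ⟨i, rfl⟩
      exact ⟨f i, rfl⟩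
    · rw [Submodule.span_le]
      rintro _ ⟨i, rfl⟩
      by_cases hi : i ∈ Set.range f
      · obtain ⟨i', rfl⟩ := hi
        exact Submodule.subset_span ⟨i', rfl⟩
      · have : Q.row i = 0 := h0 i hi
        rw [this]
        exact Submodule.zero_mem _
  rw [this]

omit [CharZero F] in
/-- A left-invertible integer matrix has invertible determinant over any field. [folklore] -/
theorem isUnit_det_map_intCast {m : ℕ} {UH UH' : Matrix (Fin m) (Fin m) ℤ} (h : UH' * UH = 1) :
    IsUnit (UH.map (Int.cast : ℤ → F)).det := by
  refine Matrix.isUnit_det_of_left_inverse (B := UH'.map (Int.cast : ℤ → F)) ?_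
  rw [show (Int.cast : ℤ → F) = ⇑(Int.castRingHom F) from (Int.coe_castRingHom (α := F)).symm,
    ← Matrix.map_mul, h, Matrix.map_one _ (map_zero _) (map_one _)]

end Lemmas

/-! ### The Schanuel bound relative to `H`, with an additive block -/

section Main

/-- **The one-field Schanuel bound, horizontal and relative to an ambient subtorus** (the algebraic
core of Bays–Kirby 2018, Thm 11.4 / Kirby 2009, Thm 4.6, from Ax's theorem
`ax_schanuel_of_field`). Data: derivations `D₁, …, D_{N'+m}` of a field `F` of characteristic zero; an additive
block `u ∈ F^{N'}`; logarithms `x ∈ Fᵐ` of a torus point `y` (`D yᵢ = yᵢ D xᵢ`); a tuple `x'`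
with `x = V' x'` for a constant matrix `V'` and `x'ᵢ` constant for `i ∈ J` (the coset relations,
`x' = V x` for the inverse `V` of `V'`); an integer unimodular `U_H` with `(U_H x)ᵢ` constant for `i ∈ I_H` (the ambient
subtorus `H`); sets `S_y`, `S_u` of coordinates on which the Jacobian is the identity, the
derivations of index in `S_u` killing `y`; and a set `k'` of constants with
`relRank k' (u ∪ y) ≤ d` in the algebraic matroid of `F/ℚ`. If `d + |I_H| < |S_y| + |S_u| + |J|`
then some integer combination of the `H`-adapted logarithms `(U_H x)ᵢ`, supported off `I_H`, is
a constant. See the module docstring for the count.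
[cite: Kirby2009, Thm 4.6 (proof)] [cite: BaysKirby2018ANT, Thm 11.4] -/
theorem exists_int_relation_rel {N' m : ℕ} (D : Fin (N' + m) → Derivation ℤ F F)
    (u : Fin N' → F) (x y x' : Fin m → F)
    (hy : ∀ i, y i ≠ 0) (hexp : ∀ j i, D j (y i) = y i * D j (x i))
    (V' : Matrix (Fin m) (Fin m) F) (hV' : ∀ j i l, D j (V' i l) = 0)
    (hx : ∀ i, x i = ∑ l, V' i l * x' l)
    (J : Finset (Fin m)) (hJ : ∀ i ∈ J, ∀ j, D j (x' i) = 0)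
    (UH UH' : Matrix (Fin m) (Fin m) ℤ) (hU'U : UH' * UH = 1)
    (IH : Finset (Fin m)) (hIH : ∀ i ∈ IH, ∀ j, D j (∑ l, (UH i l : F) * x l) = 0)
    (Sy : Finset (Fin m))
    (hSy : ∀ i ∈ Sy, ∀ j, D j (x i) = (Pi.single (finSumFinEquiv (Sum.inr i)) (1 : F) : _ → F) j)
    (Su : Finset (Fin N'))
    (hSu : ∀ s ∈ Su, ∀ j, D j (u s) = (Pi.single (finSumFinEquiv (Sum.inl s)) (1 : F) : _ → F) j)
    (hSu_y : ∀ s ∈ Su, ∀ i, D (finSumFinEquiv (Sum.inl s)) (y i) = 0)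
    (k' : Set F) (hk' : ∀ z ∈ k', ∀ j, D j z = 0) {d : ℕ}
    (hd : (algMatroid F).relRank k' (Set.range u ∪ Set.range y) ≤ d)
    (hlt : d + IH.card < Sy.card + Su.card + J.card) :
    ∃ r : Fin m → ℤ, r ≠ 0 ∧ (∀ i ∈ IH, r i = 0) ∧
      ∀ j, D j (∑ i, (r i : F) * ∑ l, (UH i l : F) * x l) = 0 := by
  classical
  by_contra hcon
  push Not at hcon
  -- the field of constants `K₀` and the derivations over it
  set K₀ : IntermediateField ℚ F := kerField D with hK₀
  let Dk : Fin (N' + m) → Derivation K₀ F F := fun j => overField K₀ (D j) fun z hz => hz j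
  have hC : ∀ a : F, (∀ j, Dk j a = 0) → a ∈ Set.range (algebraMap K₀ F) :=
    fun a ha => ⟨⟨a, fun j => ha j⟩, rfl⟩
  have hk'K₀ : k' ⊆ (K₀ : Set F) := fun z hz j => hk' z hz j
  -- the `H`-adapted logarithms and monomials, indexed by `Fin n₀ ≃ {i // i ∉ I_H}`
  let xf : Fin m → F := fun i => ∑ l, (UH i l : F) * x l
  let yf : Fin m → F := fun i => ∏ l, y l ^ UH i l
  set n₀ : ℕ := Fintype.card {i : Fin m // i ∉ IH} with hn₀
  let e : Fin n₀ ≃ {i : Fin m // i ∉ IH} := (Fintype.equivFin _).symm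
  let xt : Fin n₀ → F := fun i' => xf (e i').1
  let yt : Fin n₀ → F := fun i' => yf (e i').1
  have hn₀m : n₀ + IH.card = m := by
    have h1 : Fintype.card {i : Fin m // i ∉ IH} = (IHᶜ).card := by
      rw [Fintype.card_subtype]; congr 1; ext i; simp
    rw [hn₀, h1, Finset.card_compl, Fintype.card_fin]
    have := IH.card_le_univ
    rw [Fintype.card_fin] at this
    omega
  -- hypotheses of Ax's theorem for `(xt, yt)`
  have hyt : ∀ i', yt i' ≠ 0 := fun i' =>
    Finset.prod_ne_zero_iff.mpr fun l _ => zpow_ne_zero _ (hy l)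
  have hexpt : ∀ j i', Dk j (yt i') = yt i' * Dk j (xt i') := fun j i' =>
    derivation_prod_zpow (D j) x y hy (fun l => hexp j l) _
  have hind : ∀ q : Fin n₀ → ℤ, (∀ j, Dk j (∑ i', (q i' : F) * xt i') = 0) → q = 0 := by
    intro q hq
    -- extend `q` by zero to `r : Fin m → ℤ`
    let r : Fin m → ℤ := fun i => if h : i ∉ IH then q (e.symm ⟨i, h⟩) else 0
    have hrIH : ∀ i ∈ IH, r i = 0 := fun i hi => by simp [r, hi]
    have hsum : ∑ i, (r i : F) * xf i = ∑ i', (q i' : F) * xt i' := by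
      -- split the sum over `Fin m` into `i ∉ IH` (reindexed by `e`) and `i ∈ IH` (zero terms)
      have h1 : ∑ i, (r i : F) * xf i = ∑ i : {i : Fin m // i ∉ IH}, (r i.1 : F) * xf i.1 := by
        have hsplit := Fintype.sum_subtype_add_sum_subtype (fun i : Fin m => i ∉ IH)
          (fun i => (r i : F) * xf i)
        have hzero : ∑ i : {i : Fin m // ¬ (i ∉ IH)}, (r i.1 : F) * xf i.1 = 0 :=
          Finset.sum_eq_zero fun i _ => by
            have hi : ¬ ((i : Fin m) ∉ IH) := i.2
            simp only [r, dif_neg hi, Int.cast_zero, zero_mul]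
        rw [hzero, add_zero] at hsplit
        exact hsplit.symm
      rw [h1, ← e.sum_comp]
      refine Finset.sum_congr rfl fun i' _ => ?_
      have h2 : r (e i').1 = q i' := by
        simp only [r, dif_pos (e i').2]
        congr 1
        exact e.symm_apply_apply i'
      rw [h2]
    by_contra hq0
    have hr0 : r ≠ 0 := by
      intro hr
      apply hq0
      funext i'
      have := congrFun hr (e i').1
      simp only [r, dif_pos (e i').2, Pi.zero_apply] at this
      rwa [e.symm_apply_apply] at this
    obtain ⟨j, hj⟩ := hcon r hr0 hrIH
    apply hj
    show D j (∑ i, (r i : F) * xf i) = 0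
    rw [hsum]
    exact hq j
  have hAS := ax_schanuel_of_field Rosenlicht.Rosenlicht1976_prop4_holds Dk hC xt yt hyt hexpt hind
  -- (1) the rank term is at least `|S_y|`
  set Mt : Matrix (Fin n₀) (Fin (N' + m)) F := Matrix.of fun i' j => Dk j (xt i') with hMt
  set P : Matrix (Fin m) (Fin (N' + m)) F := Matrix.of fun l j => D j (x l) with hP
  set Q : Matrix (Fin m) (Fin (N' + m)) F := Matrix.of fun i j => D j (xf i) with hQ
  have hQP : Q = UH.map (Int.cast : ℤ → F) * P := by
    ext i j
    rw [hQ, Matrix.of_apply, Matrix.mul_apply]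
    show D j (∑ l, (UH i l : F) * x l) = _
    rw [derivation_sum_intCast_mul]
    rfl
  have hMtQ : Mt = Q.submatrix (fun i' => (e i').1) id := by
    ext i' j; rfl
  have hrankQ : Q.rank = P.rank := by
    rw [hQP]
    exact Matrix.rank_mul_eq_right_of_isUnit_det _ _ (isUnit_det_map_intCast hU'U)
  have hrankMt : Mt.rank = Q.rank := by
    rw [hMtQ]
    refine rank_submatrix_eq_of_rows_eq_zero Q _ fun i hi => ?_
    have hiIH : i ∈ IH := by
      by_contra hi'
      exact hi ⟨e.symm ⟨i, hi'⟩, by simp⟩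
    funext j
    rw [hQ, Matrix.of_apply]
    exact hIH i hiIH j
  have hrankP : Sy.card ≤ P.rank := by
    rw [Matrix.rank_eq_finrank_span_row]
    have hrow : ∀ i ∈ Sy, P.row i = Pi.single (finSumFinEquiv (Sum.inr i)) (1 : F) := by
      intro i hi
      funext j
      exact hSy i hi j
    have hli : LinearIndependent F (fun i : Sy =>
        (Pi.single (finSumFinEquiv (Sum.inr (i : Fin m))) (1 : F) : Fin (N' + m) → F)) := by
      have h1 := (Pi.basisFun F (Fin (N' + m))).linearIndependent
      have h2 : (fun i : Sy =>
          (Pi.single (finSumFinEquiv (Sum.inr (i : Fin m))) (1 : F) : Fin (N' + m) → F)) =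
          (Pi.basisFun F (Fin (N' + m))) ∘ (fun i : Sy => finSumFinEquiv (Sum.inr (i : Fin m))) := by
        funext i; simp [Pi.basisFun_apply]
      rw [h2]
      refine h1.comp _ fun a b hab => ?_
      exact Subtype.ext (Sum.inr_injective (finSumFinEquiv.injective hab))
    have hsub : Set.range (fun i : Sy =>
        (Pi.single (finSumFinEquiv (Sum.inr (i : Fin m))) (1 : F) : Fin (N' + m) → F)) ⊆
        Set.range P.row := by
      rintro _ ⟨i, rfl⟩
      exact ⟨i, hrow i i.2⟩
    calc Sy.card = Fintype.card Sy := (Fintype.card_coe Sy).symm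
      _ = Module.finrank F (Submodule.span F (Set.range (fun i : Sy =>
            (Pi.single (finSumFinEquiv (Sum.inr (i : Fin m))) (1 : F) : Fin (N' + m) → F)))) :=
          (finrank_span_eq_card hli).symm
      _ ≤ Module.finrank F (Submodule.span F (Set.range P.row)) :=
          Submodule.finrank_mono (Submodule.span_mono hsub)
  have hrank : Sy.card ≤ Mt.rank := by rw [hrankMt, hrankQ]; exact hrankP
  -- (2) pass to relative ranks in the algebraic matroid of `F/ℚ`
  set Mm := algMatroid F with hMm
  have hAS' : ((n₀ + Sy.card : ℕ) : ℕ∞) ≤ Mm.relRank (K₀ : Set F) (Set.range xt ∪ Set.range yt) := by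
    have h1 : ((n₀ + Mt.rank : ℕ) : Cardinal) ≤
        Algebra.trdeg K₀ (Algebra.adjoin K₀ (Set.range xt ∪ Set.range yt)) := hAS
    have h2 := OrderHomClass.mono Cardinal.toENat h1
    rw [map_natCast, ZilberSaturationMain.toENat_trdeg_algebra_adjoin_eq_relRank] at h2
    refine le_trans ?_ h2
    exact_mod_cast Nat.add_le_add_left hrank n₀
  -- (3) `xt, yt` lie in the algebraic closure of `K₀ ∪ x' ∪ y`
  have hcl : Set.range xt ∪ Set.range yt ⊆
      Mm.closure ((x' '' ((Jᶜ : Finset (Fin m)) : Set (Fin m)) ∪ Set.range y) ∪ (K₀ : Set F)) := by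
    -- everything lies in the subfield generated by `K₀ ∪ x' '' Jᶜ ∪ y`
    set T : Set F := (x' '' ((Jᶜ : Finset (Fin m)) : Set (Fin m)) ∪ Set.range y) ∪ (K₀ : Set F)
      with hT
    have hx'T : ∀ k, x' k ∈ Subfield.closure T := by
      intro k
      by_cases hk : k ∈ J
      · refine Subfield.subset_closure (Or.inr ?_)
        show x' k ∈ K₀
        exact fun j => hJ k hk j
      · exact Subfield.subset_closure (Or.inl (Or.inl ⟨k, by simpa using hk, rfl⟩))
    have hxT : ∀ l, x l ∈ Subfield.closure T := by
      intro l
      rw [hx l]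
      refine Subfield.sum_mem _ fun k _ => Subfield.mul_mem _ ?_ (hx'T k)
      refine Subfield.subset_closure (Or.inr ?_)
      show V' l k ∈ K₀
      exact fun j => hV' j l k
    have hxfT : ∀ i, xf i ∈ Subfield.closure T := fun i =>
      Subfield.sum_mem _ fun l _ => Subfield.mul_mem _ (intCast_mem _ _) (hxT l)
    have hyT : ∀ l, y l ∈ Subfield.closure T := fun l =>
      Subfield.subset_closure (Or.inl (Or.inr ⟨l, rfl⟩))
    have hyfT : ∀ i, yf i ∈ Subfield.closure T := fun i =>
      Subfield.prod_mem _ fun l _ => zpow_mem (hyT l) _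
    have hTcl : (Subfield.closure T : Set F) ⊆ Mm.closure T := subfieldClosure_subset_acl T
    rintro z (⟨i', rfl⟩ | ⟨i', rfl⟩)
    · exact hTcl (hxfT _)
    · exact hTcl (hyfT _)
  have h3 : Mm.relRank (K₀ : Set F) (Set.range xt ∪ Set.range yt) ≤
      Mm.relRank (K₀ : Set F) (x' '' ((Jᶜ : Finset (Fin m)) : Set (Fin m)) ∪ Set.range y) :=
    Mm.relRank_le_of_subset_closure _ hcl
  -- (4) split off the at most `m - |J|` logarithms
  have h4 : Mm.relRank (K₀ : Set F) (x' '' ((Jᶜ : Finset (Fin m)) : Set (Fin m)) ∪ Set.range y) ≤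
      ((m - J.card : ℕ) : ℕ∞) + Mm.relRank (K₀ : Set F) (Set.range y) := by
    refine (Mm.relRank_union_le _ _ _).trans (add_le_add ?_ le_rfl)
    refine (Mm.relRank_le_encard_diff _ _).trans ((Set.encard_le_encard Set.sdiff_subset).trans ?_)
    refine (Set.encard_image_le _ _).trans ?_
    rw [Set.encard_coe_eq_coe_finsetCard, Finset.card_compl, Fintype.card_fin]
  -- (5) over the smaller set of constants `k'`
  have h5 : Mm.relRank (K₀ : Set F) (Set.range y) ≤ Mm.relRank k' (Set.range y) :=
    Mm.relRank_anti_left _ hk'K₀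
  -- (6) `u` on `S_u` is algebraically independent over `ℚ(k', y)`: `relRank k' y + |S_u| ≤ d`
  have h6 : Mm.relRank k' (Set.range y) + Su.card ≤ d := by
    set L : IntermediateField ℚ F := IntermediateField.adjoin ℚ (k' ∪ Set.range y) with hL
    let E : Su → Derivation ℤ F F := fun s => D (finSumFinEquiv (Sum.inl (s : Fin N')))
    have hEL : ∀ s, ∀ z ∈ L, E s z = 0 := by
      intro s
      have hle : L ≤ kerField E := by
        rw [hL, IntermediateField.adjoin_le_iff]
        rintro z (hz | ⟨i, rfl⟩)
        · exact fun s' => hk' z hz _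
        · exact fun s' => hSu_y _ s'.2 i
      intro z hz
      exact (hle hz) s
    let uS : Su → F := fun s => u s
    have hjac : ∀ s t : Su, E s (uS t) = (Pi.single t (1 : F) : Su → F) s := by
      intro s t
      show D (finSumFinEquiv (Sum.inl (s : Fin N'))) (u t) = _
      rw [hSu _ t.2, Pi.single_apply, Pi.single_apply]
      by_cases hst : s = t
      · subst hst; simp
      · have : (finSumFinEquiv (Sum.inl (s : Fin N')) : Fin (N' + m)) ≠
            finSumFinEquiv (Sum.inl (t : Fin N')) := fun h =>
          hst (Subtype.ext (Sum.inl_injective (finSumFinEquiv.injective h)))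
        rw [if_neg this, if_neg hst]
    have hind : AlgebraicIndependent L uS := algebraicIndependent_of_jacobian L E hEL uS hjac
    have hinj : Function.Injective uS := hind.injective
    -- independence in the contraction by `L`
    have hcontr : (Mm ／ (L : Set F)).Indep (Set.range uS) := by
      refine contract_indep_of_algebraicIndepOn L ?_
      exact hind.to_subtype_range
    have hrk : Mm.relRank (L : Set F) (Set.range uS) = Su.card := by
      rw [relRank_eq_eRk_contract, hcontr.eRk_eq_encard, ← Set.image_univ,
        hinj.injOn.encard_image, Set.encard_univ, ENat.card_eq_coe_fintype_card, Fintype.card_coe]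
    -- `relRank k' (y ∪ uS) = relRank k' y + relRank (k' ∪ y) uS`
    have hclL : Mm.closure (L : Set F) = Mm.closure (k' ∪ Set.range y) := acl_adjoin _
    have hadd : Mm.relRank k' (k' ∪ Set.range y) + Mm.relRank (k' ∪ Set.range y)
        ((k' ∪ Set.range y) ∪ Set.range uS) = Mm.relRank k' ((k' ∪ Set.range y) ∪ Set.range uS) :=
      Mm.relRank_add_relRank subset_union_left subset_union_left
    have hA : Mm.relRank k' (k' ∪ Set.range y) = Mm.relRank k' (Set.range y) :=
      Mm.relRank_union_self_left _ _
    have hB : Mm.relRank (k' ∪ Set.range y) ((k' ∪ Set.range y) ∪ Set.range uS) = Su.card := by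
      rw [Mm.relRank_union_self_left, ← hrk,
        Mm.relRank_congr_closure_left (Set.range uS) hclL.symm]
    have hCle : Mm.relRank k' ((k' ∪ Set.range y) ∪ Set.range uS) ≤ d := by
      rw [Set.union_assoc, Mm.relRank_union_self_left]
      refine le_trans (Mm.relRank_mono_right _ ?_) hd
      rintro z (hz | ⟨s, rfl⟩)
      · exact Or.inr hz
      · exact Or.inl ⟨s, rfl⟩
    rw [hA, hB] at hadd
    rw [hadd]
    exact hCle
  -- (7) counting
  have hfin : Mm.relRank k' (Set.range y) ≠ ⊤ := by
    intro htop
    rw [htop, top_add] at h6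
    exact ENat.coe_ne_top d (le_antisymm le_top h6)
  obtain ⟨ρy, hρy⟩ := ENat.ne_top_iff_exists.1 hfin
  rw [← hρy] at h5 h6
  have hchain := (hAS'.trans h3).trans (h4.trans (add_le_add le_rfl h5))
  have hnat1 : n₀ + Sy.card ≤ (m - J.card) + ρy := by
    have : ((n₀ + Sy.card : ℕ) : ℕ∞) ≤ ((m - J.card + ρy : ℕ) : ℕ∞) := by push_cast at hchain ⊢; exact hchain
    exact_mod_cast this
  have hnat2 : ρy + Su.card ≤ d := by
    have : ((ρy + Su.card : ℕ) : ℕ∞) ≤ (d : ℕ∞) := by push_cast at h6 ⊢; exact h6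
    exact_mod_cast this
  have hJm : J.card ≤ m := by simpa only [Fintype.card_fin] using J.card_le_univ
  omega

end Main

end Literature.NumberTheory.Transcendental.WeakZP
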